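/-
Copyright (c) 2026 the pub-hodgecm-mathlib formalisation cell (harness21).  Prover seat hodgecm-mathlib-LH10-p01 (g12): road M6 → F5 → dyadic chain of `stub_DyUnramCore` (D-UNR),
research brick (L2-3)-θ part 4 «THE HERMITIAN CAYLEY SHIFT: THE SHIFTED ORDER `𝒪[W] = 𝒪[φ(M)]` — 2-free» (MEMO-L23-θSHIFT v1); 2026-09-03.
-/
import Literature.NumberTheory.Automorphic.MatrixMoebiusShift   -- ★ α (F0P2-p06): §2–§4 `inv_mem_adjoin_of_charpoly_coeff_mem`, `smul_one_add_smul_mem_adjoin`, `forall_mem_*`, the σ-fixed originals `moebius_mem_adjoin` ∕ `mem_adjoin_moebius`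
import HarnessLib

/-!
# The shifted order of the hermitian Cayley shift: `Y = (1 + θW)(1 + (c−θ′)W)⁻¹` and `W` generate the same `O`-order, for `θ + θ′ = 1`, `1 − c` and `c − θ′` units — no `2`

Topic `NumberTheory/Automorphic`; namespace `Literature.NumberTheory.Automorphic.MoebiusShift` (= ★ α's).  THEOREMS ONLY (no definition, no instance, no notation, no named fact, no `sorry`);
kernel lane `--supports stmt-HodgeConjecture-24833`.  Cell `pub/hodgecm-mathlib` (D-0151), crux H413 = `stmt-HodgeConjecture-24833`; road M6 → F5 → the dyadic chain of organ (D-UNR)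
`stub_DyUnramCore`, LEVEL TWO, site (L2-3) «THE WALL» (FINDING #7); fourth brick of this seat's θ-shift series (p853610 level lemma; parts 2–3 `TypeTwoHermitianMoebiusShift{Valued,Frame}`).
★ α §4 proves, for the σ-FIXED pair, `φ(M), φ(M)⁻¹ ∈ 𝒪[W]` and `W ∈ 𝒪[φ(M)]` (`M = 1 + cW`, `φ(M) = N₊N₋⁻¹`, `N± = 2 + (c±1)W`) — the order identity behind ★ `TypeTwoCayleyShiftOrderCM` ∕
★ `CayleyShiftOrderDeepCM` — and its converse inclusion `mem_adjoin_moebius` binds `h2 : ∃ e ∈ O, e * 2 = 1` (`((c+1) − (c−1)φ(M))·N₋ = 4`).  THIS FILE: for the hermitian pair in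
cofactor form, `Np = 1 + θ•W`, `Nm = 1 + (c−θ′)•W` with `θ + θ′ = 1` (`θ′` standing for `σθ`; no `σ` is needed here), `Y = Np·Nm⁻¹`: §1 `Y, Y⁻¹ ∈ 𝒪[W]` (units `det Nm`, `det Np`);
§2 the key identity **`(θ•1 − (c−θ′)•Y)·Nm = (1 − c)•1`** (`θ·Nm − (c−θ′)·Np = (θ + θ′ − c)•1`); §3 **`W ∈ 𝒪[Y]`** when `1 − c`, `c − θ′` and `det Nm` are units of `O` — by
Cayley–Hamilton exactly as in ★, with `4 ↦ 1 − c` and `(c−1)⁻¹ ↦ (c−θ′)⁻¹`; for `O` the valuation ring, `|c| < 1` and `θ` integral with `θ + σθ = 1` (`σ` isometric) all three side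
conditions hold at EVERY residue characteristic (`|1 − c| = 1`; `|c − σθ| = |σθ| = 1` — part 3 `valued_map_eq_one_of_add_map_eq_one`; `det Nm` by part 2 `valued_det_one_add_smul_eq_one_of_skew_hermitian`).
HONEST LABEL: count-neutral research brick (commutative algebra over a field); no claim on L2-3 beyond the lemmas printed; HC_CM is proved only modulo the 7 printed citations
(2 remaining named inputs: hLiu418 = stmt-HodgeConjecture-24832, h413 = stmt-HodgeConjecture-24833) until rung 0 closes.

## References
* [Kottwitz1986BaseChangeUnits] R. E. Kottwitz, *Base change for unit elements of Hecke algebras*, Compositio Math. 60 (1986): §2 pp. 244–247 (the shifted order).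
* [Weyl1939] H. Weyl, *The Classical Groups* (1939): Chap. II §10 p. 56.
* [HornJohnson2013] R. A. Horn, C. R. Johnson, *Matrix Analysis*, 2nd ed. (2013): §0.8.2, §2.1 (Cayley–Hamilton inversion).
* [SerreLocalFields1979] J.-P. Serre, *Local Fields*, GTM 67 (1979): Ch. I §§1–2.
-/

set_option autoImplicit false

noncomputable section

open Matrix Polynomial

namespace Literature.NumberTheory.Automorphic.MoebiusShift

section Order

variable {K : Type*} [Field K] {n : Type*} [Fintype n] [DecidableEq n] (O : Subring K)

/-! ## §1 `Y = Np·Nm⁻¹` and `Y⁻¹` lie in `𝒪[W]` -/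

/-- **`Y = (1 + θW)(1 + tW)⁻¹ ∈ 𝒪[W]`** when `W` is entrywise in `O`, `θ, t ∈ O` and `det(1 + tW)` is a unit of `O` (★ α `moebius_mem_adjoin` with `(2, c+1, c−1) ↦ (1, θ, t)`).
[cite: Kottwitz1986BaseChangeUnits, §2 pp. 244–247] [cite: HornJohnson2013, §2.1] -/
theorem hermitianMoebius_mem_adjoin {W : Matrix n n K} (hW : ∀ i j, W i j ∈ O) {θ t : K} (hθ : θ ∈ O) (ht : t ∈ O)
    (hm : ∃ d ∈ O, d * ((1 : K) • (1 : Matrix n n K) + t • W).det = 1) :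
    ((1 : K) • (1 : Matrix n n K) + θ • W) * ((1 : K) • (1 : Matrix n n K) + t • W)⁻¹ ∈ Algebra.adjoin O ({W} : Set (Matrix n n K)) := by
  refine Subalgebra.mul_mem _ (smul_one_add_smul_mem_adjoin O W O.one_mem hθ) ?_
  exact inv_mem_adjoin_of_charpoly_coeff_mem O (smul_one_add_smul_mem_adjoin O W O.one_mem ht)
    (charpoly_coeff_mem_of_forall_mem O (forall_mem_smul_one_add_smul O hW O.one_mem ht)) hm

/-- **`Y⁻¹ = (1 + tW)(1 + θW)⁻¹ ∈ 𝒪[W]`** when moreover `det(1 + θW)` is a unit of `O` (★ α `moebius_inv_mem_adjoin`). [cite: Kottwitz1986BaseChangeUnits, §2 pp. 244–247] -/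
theorem hermitianMoebius_inv_mem_adjoin {W : Matrix n n K} (hW : ∀ i j, W i j ∈ O) {θ t : K} (hθ : θ ∈ O) (ht : t ∈ O)
    (hm : ∃ d ∈ O, d * ((1 : K) • (1 : Matrix n n K) + t • W).det = 1) (hp : ∃ d ∈ O, d * ((1 : K) • (1 : Matrix n n K) + θ • W).det = 1) :
    (((1 : K) • (1 : Matrix n n K) + θ • W) * ((1 : K) • (1 : Matrix n n K) + t • W)⁻¹)⁻¹ ∈ Algebra.adjoin O ({W} : Set (Matrix n n K)) := by
  have hmu : IsUnit ((1 : K) • (1 : Matrix n n K) + t • W).det := by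
    obtain ⟨d, -, hd⟩ := hm; exact IsUnit.of_mul_eq_one_right d hd
  rw [Matrix.mul_inv_rev, Matrix.nonsing_inv_nonsing_inv _ hmu]
  refine Subalgebra.mul_mem _ (smul_one_add_smul_mem_adjoin O W O.one_mem ht) ?_
  exact inv_mem_adjoin_of_charpoly_coeff_mem O (smul_one_add_smul_mem_adjoin O W O.one_mem hθ)
    (charpoly_coeff_mem_of_forall_mem O (forall_mem_smul_one_add_smul O hW O.one_mem hθ)) hp

/-! ## §2 The key identity of the inverse shift: `(θ − (c−θ′)Y)·Nm = (1 − c)•1` -/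

omit [Fintype n] in
/-- `θ·Nm − (c−θ′)·Np = (θ + θ′ − c)•1 = (1 − c)•1` for `Np = 1 + θW`, `Nm = 1 + (c−θ′)W`, `θ + θ′ = 1` — the `W`-terms cancel. [cite: Weyl1939, Chap. II §10] -/
theorem smul_denom_sub_smul_numer_eq (W : Matrix n n K) {θ θ' : K} (hθ : θ + θ' = 1) (c : K) :
    θ • ((1 : K) • (1 : Matrix n n K) + (c - θ') • W) - (c - θ') • ((1 : K) • (1 : Matrix n n K) + θ • W) = (1 - c) • (1 : Matrix n n K) := by
  have e : θ - (c - θ') = 1 - c := by linear_combination hθ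
  rw [smul_add, smul_add, smul_smul, smul_smul, smul_smul, smul_smul, mul_one, mul_one, mul_comm (c - θ') θ, add_sub_add_right_eq_sub, ← sub_smul, e]

/-- **`(θ•1 − (c−θ′)•Y)·Nm = (1 − c)•1`** for `Y = Np·Nm⁻¹`, `det Nm` a unit (★ α `sub_smul_moebius_mul_eq` has `4` on the right). [cite: Weyl1939, Chap. II §10] -/
theorem sub_smul_hermitianMoebius_mul_eq (W : Matrix n n K) {θ θ' : K} (hθ : θ + θ' = 1) (c : K) (hN : IsUnit ((1 : K) • (1 : Matrix n n K) + (c - θ') • W).det) :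
    (θ • (1 : Matrix n n K) - (c - θ') • (((1 : K) • (1 : Matrix n n K) + θ • W) * ((1 : K) • (1 : Matrix n n K) + (c - θ') • W)⁻¹)) *
        ((1 : K) • (1 : Matrix n n K) + (c - θ') • W) = (1 - c) • (1 : Matrix n n K) := by
  rw [sub_mul, smul_mul_assoc, smul_mul_assoc, Matrix.one_mul, Matrix.mul_assoc, Matrix.nonsing_inv_mul _ hN, Matrix.mul_one]
  exact smul_denom_sub_smul_numer_eq W hθ c

/-! ## §3 `W ∈ 𝒪[Y]`: the two orders coincide -/

/-- **`W ∈ 𝒪[Y]`**, `Y = (1 + θW)(1 + (c−θ′)W)⁻¹`, `θ + θ′ = 1`: with `D = θ•1 − (c−θ′)•Y` one has `D·Nm = (1−c)•1`, so `Nm = (1−c)·D⁻¹ ∈ 𝒪[Y]` by Cayley–Hamilton (`D` entrywise in `O`,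
`det D·det Nm = (1−c)ⁿ`) and `W = (c−θ′)⁻¹(Nm − 1)`; needs `1 − c`, `c − θ′`, `det Nm` units of `O` and `θ, θ′, c ∈ O` — NOT `2` (★ α `mem_adjoin_moebius` twin).
[cite: Kottwitz1986BaseChangeUnits, §2 pp. 244–247] [cite: HornJohnson2013, §2.1] -/
theorem mem_adjoin_hermitianMoebius {W : Matrix n n K} (hW : ∀ i j, W i j ∈ O) {θ θ' c : K} (hθO : θ ∈ O) (hθ'O : θ' ∈ O) (hcO : c ∈ O) (hθ : θ + θ' = 1)
    (h1c : ∃ e ∈ O, e * (1 - c) = 1) (hct : ∃ e ∈ O, e * (c - θ') = 1) (hm : ∃ d ∈ O, d * ((1 : K) • (1 : Matrix n n K) + (c - θ') • W).det = 1) :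
    W ∈ Algebra.adjoin O ({((1 : K) • (1 : Matrix n n K) + θ • W) * ((1 : K) • (1 : Matrix n n K) + (c - θ') • W)⁻¹} : Set (Matrix n n K)) := by
  have htO : c - θ' ∈ O := O.sub_mem hcO hθ'O
  set Np : Matrix n n K := (1 : K) • (1 : Matrix n n K) + θ • W with hNp
  set Nm : Matrix n n K := (1 : K) • (1 : Matrix n n K) + (c - θ') • W with hNm
  set Y : Matrix n n K := Np * Nm⁻¹ with hY
  set D : Matrix n n K := θ • (1 : Matrix n n K) - (c - θ') • Y with hDdef
  obtain ⟨dm, hdmO, hdm⟩ := hm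
  obtain ⟨e, heO, he⟩ := h1c
  obtain ⟨e1, he1O, he1⟩ := hct
  have hmu : IsUnit Nm.det := IsUnit.of_mul_eq_one_right dm hdm
  have hkey : D * Nm = (1 - c) • (1 : Matrix n n K) := sub_smul_hermitianMoebius_mul_eq W hθ c hmu
  -- `D` is entrywise integral, lies in `𝒪[Y]`, and `det D · det Nm = (1−c)ⁿ`
  have hYint : ∀ i j, Y i j ∈ O :=
    forall_mem_mul O (forall_mem_smul_one_add_smul O hW O.one_mem hθO) (forall_mem_inv O (forall_mem_smul_one_add_smul O hW O.one_mem htO) ⟨dm, hdmO, hdm⟩)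
  have hDint : ∀ i j, D i j ∈ O := by
    rw [hDdef, sub_eq_add_neg, ← neg_smul]
    exact forall_mem_smul_one_add_smul O hYint hθO (O.neg_mem htO)
  have hDmem : D ∈ Algebra.adjoin O ({Y} : Set (Matrix n n K)) := by
    rw [hDdef, sub_eq_add_neg, ← neg_smul]
    exact smul_one_add_smul_mem_adjoin O Y hθO (O.neg_mem htO)
  have hdet : D.det * Nm.det = (1 - c) ^ Fintype.card n := by
    rw [← Matrix.det_mul, hkey, Matrix.det_smul, Matrix.det_one, mul_one]
  have hDunit : ∃ d ∈ O, d * D.det = 1 := by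
    refine ⟨Nm.det * e ^ Fintype.card n, O.mul_mem (det_mem_of_forall_mem O (forall_mem_smul_one_add_smul O hW O.one_mem htO)) (O.pow_mem heO _), ?_⟩
    calc Nm.det * e ^ Fintype.card n * D.det = (D.det * Nm.det) * e ^ Fintype.card n := by ring
      _ = 1 := by rw [hdet, ← mul_pow, mul_comm, he, one_pow]
  have hDinv : D⁻¹ ∈ Algebra.adjoin O ({Y} : Set (Matrix n n K)) :=
    inv_mem_adjoin_of_charpoly_coeff_mem O hDmem (charpoly_coeff_mem_of_forall_mem O hDint) hDunit
  -- `Nm = (1−c) · D⁻¹` and `W = (c−θ′)⁻¹ (Nm − 1)`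
  have hDu : IsUnit D.det := by obtain ⟨d, -, hd⟩ := hDunit; exact IsUnit.of_mul_eq_one_right d hd
  have hNm_eq : Nm = (1 - c) • D⁻¹ := by
    calc Nm = D⁻¹ * (D * Nm) := by rw [← Matrix.mul_assoc, Matrix.nonsing_inv_mul _ hDu, Matrix.one_mul]
      _ = (1 - c) • D⁻¹ := by rw [hkey, mul_smul_comm, Matrix.mul_one]
  have hNm_mem : Nm ∈ Algebra.adjoin O ({Y} : Set (Matrix n n K)) := by
    rw [hNm_eq]; exact smul_mem_adjoin_of_mem O hDinv (O.sub_mem O.one_mem hcO)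
  have hW_eq : W = e1 • (Nm - (1 : K) • (1 : Matrix n n K)) := by
    rw [hNm, add_sub_cancel_left, smul_smul, he1, one_smul]
  rw [hW_eq]
  exact smul_mem_adjoin_of_mem O (Subalgebra.sub_mem _ hNm_mem (smul_mem_adjoin_of_mem O (Subalgebra.one_mem _) O.one_mem)) he1O

end Order

end Literature.NumberTheory.Automorphic.MoebiusShift

end
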